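import Literature.AlgebraicGeometry.Resolution.RegularSystemOfParameters
import Literature.AlgebraicGeometry.Resolution.MarkedIdeals
import Literature.AlgebraicGeometry.Resolution.StalkIdealLemmas
import Mathlib.RingTheory.Nakayama
import Mathlib.LinearAlgebra.Finsupp.LinearCombination
import HarnessLib

/-!
# Crux `PatchingRelPerfect` (stmt-ResolutionOfSingularities-16161), chain W5.2 — F7(β) (β-AX) X3 C-I (M2b) cure §2c, LOCAL STEP: adding the
# CARRIER to a centre with simple normal crossings — `HasSNC (G :: E) → HasSNCWith E C → G ≤ C → HasSNCWith (G :: E) C`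

[OURS · L1 W5.2 · cure plan of record (res-L1-w52-lead-1 g6); res-L1-w52-tri-2 CAUTION 22:41:11Z (carrier transversality is needed on ALL of
the carrier over the piece, not only at the strict transform).]  Replaces the role of NO printed item; NOT a statement of the manuscript under
review (AI-written; AI review weaker than expert review; counted 0).  Def-free, fact-free.

If the boundary list `E` has simple normal crossings with the centre `C` (F-60΄s per-step clause, through the tree΄s
`IsNormalCrossingWith.hasSNCWith_of_hasSNC_of_isRegular`), the carrier `G` together with `E` has simple normal crossings, and `G ≤ C` (the
centre lies in the carrier hypersurface), then `G :: E` has simple normal crossings WITH `C`: at a point of `V(C) ∩ V(G)` write the carrier΄s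
generator `g = Σ_{j ∈ S} a_j u_j` in the centre΄s coordinates; some `j₀ ∈ S` outside the members΄ labels has a UNIT coefficient (else `g`
would lie in the members΄ span modulo `𝔪²`, against the minimality of the regular system displaying `G :: E` — Nakayama), and replacing
`u_{j₀}` by `g` gives a regular system displaying `G`, the members and `C` at once.  Then `HasSNCWith.hasSNC_transform` carries `G :: E`
through the blow-up (§2c, global step).

## References
* H. Matsumura, *Commutative Ring Theory* (1987), Thm. 2.2 (Nakayama), Thm. 14.2. [Matsumura1987]
* E. Bierstone, D. Grigoriev, P. Milman, J. Włodarczyk, arXiv:1206.3090, Def. 3.1.3 (2). [BierstoneGrigorievMilmanWlodarczyk2011]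
-/

-- `Summit.<Summit>.<Sub>.Theorems` with `Sub = Summit` (single-conjunct summit, D-0017)
set_option linter.dupNamespace false

noncomputable section

namespace Summit.ResolutionOfSingularities.ResolutionOfSingularities.Theorems.X3LemmaM

open CategoryTheory AlgebraicGeometry TopologicalSpace IsLocalRing
open Literature.AlgebraicGeometry.Resolution
open Scheme.IdealSheafData

universe u

/-! ## §1 Minimality of a regular system of parameters modulo `𝔪²` -/

/-- **Minimality modulo `𝔪²`**: a member of a minimal basis `x` of `𝔪` does not lie in the ideal generated by the others PLUS `𝔪²`
(Nakayama). [cite: Matsumura1987, Thm. 2.2, Thm. 14.2] -/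
theorem not_mem_span_image_sup_sq_of_not_mem {R : Type*} [CommRing R] [IsRegularLocalRing R] {d : ℕ}
    (hd : (maximalIdeal R).spanFinrank = d) (x : Fin d → R) (hx : Ideal.span (Set.range x) = maximalIdeal R)
    {S : Set (Fin d)} {i : Fin d} (hi : i ∉ S) :
    x i ∉ Ideal.span (x '' S) ⊔ (maximalIdeal R) ^ 2 := by
  classical
  intro hmem
  set T : Finset (Fin d) := Finset.univ.erase i with hT
  have hST : S ⊆ (T : Set (Fin d)) := by
    intro j hj
    rw [hT, Finset.coe_erase, Finset.coe_univ]
    exact ⟨Set.mem_univ _, fun h => hi (h ▸ hj)⟩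
  have hxm : ∀ j, x j ∈ maximalIdeal R := fun j => hx ▸ Ideal.subset_span ⟨j, rfl⟩
  -- `𝔪 ≤ (x_T) + 𝔪·𝔪`, hence `𝔪 ≤ (x_T)` by Nakayama
  have hxj : ∀ j, x j ∈ Ideal.span (x '' (T : Set (Fin d))) ⊔ maximalIdeal R • maximalIdeal R := by
    intro j
    by_cases hj : j = i
    · subst hj
      have h2 : Ideal.span (x '' S) ⊔ (maximalIdeal R) ^ 2 ≤
          Ideal.span (x '' (T : Set (Fin d))) ⊔ maximalIdeal R • maximalIdeal R := by
        rw [sq]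
        exact sup_le_sup (Ideal.span_mono (Set.image_mono hST)) le_rfl
      exact h2 hmem
    · exact Ideal.mem_sup_left (Ideal.subset_span ⟨j, by simp [hT, hj], rfl⟩)
  have hle' : maximalIdeal R ≤ Ideal.span (x '' (T : Set (Fin d))) ⊔ maximalIdeal R • maximalIdeal R :=
    calc maximalIdeal R = Ideal.span (Set.range x) := hx.symm
      _ ≤ _ := Ideal.span_le.mpr (by rintro _ ⟨j, rfl⟩; exact hxj j)
  have hle : maximalIdeal R ≤ Ideal.span (x '' (T : Set (Fin d))) :=
    Submodule.le_of_le_smul_of_le_jacobson_bot (maximalIdeal R).fg_of_isNoetherianRing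
      (IsLocalRing.maximalIdeal_le_jacobson ⊥) hle'
  have hge : Ideal.span (x '' (T : Set (Fin d))) ≤ maximalIdeal R := by
    rw [Ideal.span_le]; rintro _ ⟨j, -, rfl⟩; exact hxm j
  have heq : maximalIdeal R = Ideal.span (x '' (T : Set (Fin d))) := le_antisymm hle hge
  have hfin : (x '' (T : Set (Fin d))).Finite := (Finset.finite_toSet T).image x
  have h1 : (maximalIdeal R).spanFinrank ≤ (x '' (T : Set (Fin d))).ncard := by
    rw [heq]
    exact Submodule.spanFinrank_span_le_ncard_of_finite hfin
  have h2 : (x '' (T : Set (Fin d))).ncard ≤ d - 1 := by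
    refine (Set.ncard_image_le (Finset.finite_toSet T)).trans ?_
    rw [Set.ncard_coe_finset, hT, Finset.card_erase_of_mem (Finset.mem_univ i), Finset.card_univ, Fintype.card_fin]
  have h3 : 0 < d := Fin.pos i
  omega

/-! ## §2 Adding the carrier -/

variable {Z : Scheme.{u}}

/-- If `G` is already a member of `E`, nothing is added. [folklore] -/
theorem hasSNCWith_cons_of_mem {E : List Z.IdealSheafData} {G C : Z.IdealSheafData} (hG : G ∈ E) (hEC : HasSNCWith E C) :
    HasSNCWith (G :: E) C := by
  intro x
  obtain ⟨hreg, u, hu, ⟨ι, hι, hιu⟩, hC⟩ := hEC x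
  have hmem : ∀ D : {D // D ∈ G :: E ∧ x ∈ D.support}, D.1 ∈ E ∧ x ∈ D.1.support := fun D => by
    rcases List.mem_cons.mp D.2.1 with h | h
    · rw [h]; exact ⟨hG, h ▸ D.2.2⟩
    · exact ⟨h, D.2.2⟩
  refine ⟨hreg, u, hu, ⟨fun D => ι ⟨D.1, hmem D⟩, fun D₁ D₂ h => Subtype.ext (congrArg (fun D : {D // D ∈ E ∧ x ∈ D.support} => (D.1 : Z.IdealSheafData)) (hι h)),
    fun D => hιu ⟨D.1, hmem D⟩⟩, hC⟩

/-- [OURS · L1 W5.2 · cure §2c, local step] **ADDING THE CARRIER TO A CENTRE WITH SIMPLE NORMAL CROSSINGS.**  `HasSNC (G :: E)`, `HasSNCWith E C`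
and `G ≤ C` give `HasSNCWith (G :: E) C`. [cite: Matsumura1987, Thm. 14.2] [cite: BierstoneGrigorievMilmanWlodarczyk2011, Def. 3.1.3 (2)] -/
theorem hasSNCWith_cons_of_le {E : List Z.IdealSheafData} {G C : Z.IdealSheafData} (hGE : HasSNC (G :: E)) (hEC : HasSNCWith E C)
    (hGC : G ≤ C) : HasSNCWith (G :: E) C := by
  classical
  by_cases hGmem : G ∈ E
  · exact hasSNCWith_cons_of_mem hGmem hEC
  intro x
  -- members of `G :: E` through `x` other than `G` are members of `E`
  have hmemE : ∀ D : {D // D ∈ G :: E ∧ x ∈ D.support}, D.1 ≠ G → D.1 ∈ E ∧ x ∈ D.1.support := fun D hD => by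
    rcases List.mem_cons.mp D.2.1 with h | h
    · exact absurd h hD
    · exact ⟨h, D.2.2⟩
  by_cases hxG : x ∈ G.support
  swap
  · -- `G` does not pass through `x`: the data of `E` serve
    obtain ⟨hreg, u, hu, ⟨ι, hι, hιu⟩, hC⟩ := hEC x
    have hne : ∀ D : {D // D ∈ G :: E ∧ x ∈ D.support}, D.1 ≠ G := fun D h => hxG (h ▸ D.2.2)
    refine ⟨hreg, u, hu, ⟨fun D => ι ⟨D.1, hmemE D (hne D)⟩,
      fun D₁ D₂ h => Subtype.ext (congrArg (fun D : {D // D ∈ E ∧ x ∈ D.support} => (D.1 : Z.IdealSheafData)) (hι h)),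
      fun D => hιu ⟨D.1, hmemE D (hne D)⟩⟩, hC⟩
  by_cases hxC : x ∈ C.support
  swap
  · -- off the centre: the simple normal crossings of `G :: E` alone
    obtain ⟨hreg, u, hu, hι, -⟩ := hGE x
    exact ⟨hreg, u, hu, hι, fun h => absurd h hxC⟩
  -- the main case: `x ∈ V(C) ∩ V(G)`
  obtain ⟨hreg, u, hu, ⟨ι, hι, hιu⟩, hC⟩ := hEC x
  obtain ⟨S, hS⟩ := hC hxC
  obtain ⟨-, u', hu', ⟨ι', hι', hι'u'⟩, -⟩ := hGE x
  haveI := hreg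
  set dG : {D // D ∈ G :: E ∧ x ∈ D.support} := ⟨G, List.mem_cons_self, hxG⟩ with hdG
  set g : Z.presheaf.stalk x := u' (ι' dG) with hg
  have hGx : stalkIdeal G x = Ideal.span {g} := hι'u' dG
  have hum : ∀ j, u j ∈ maximalIdeal (Z.presheaf.stalk x) := fun j => hu ▸ Ideal.subset_span ⟨j, rfl⟩
  -- `g ∈ C_x = (u_S)`: coefficients
  have hgC : g ∈ Ideal.span (u '' S) := by
    rw [← hS]; exact stalkIdeal_mono hGC x (hGx ▸ Ideal.mem_span_singleton_self g)
  obtain ⟨l, hlS, hlg⟩ := (Finsupp.mem_span_image_iff_linearCombination (R := Z.presheaf.stalk x) (v := u)).mp hgC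
  have hl0 : ∀ j, j ∉ S → l j = 0 := fun j hj => by
    by_contra h
    exact hj (hlS (Finsupp.mem_support_iff.mpr h))
  have hsum : g = ∑ j, l j * u j := by
    rw [← hlg, Finsupp.linearCombination_apply, Finsupp.sum_fintype _ _ (fun j => by simp)]
    simp [smul_eq_mul]
  -- labels of the members of `E` through `x` under `ι`, and under `ι'`
  let toE : {D : {D // D ∈ G :: E ∧ x ∈ D.support} // D.1 ≠ G} → {D // D ∈ E ∧ x ∈ D.support} :=
    fun D => ⟨D.1.1, hmemE D.1 D.2⟩
  -- KEY: some `j₀ ∈ S` outside the members΄ labels has a unit coefficient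
  have hkey : ∃ j₀ ∈ S, (∀ D : {D // D ∈ E ∧ x ∈ D.support}, ι D ≠ j₀) ∧ IsUnit (l j₀) := by
    by_contra hno
    push Not at hno
    -- then `g ∈ (members) + 𝔪²`, where the members΄ generators are `u' (ι' D)`
    set T' : Set (Fin _) := Set.range fun D : {D : {D // D ∈ G :: E ∧ x ∈ D.support} // D.1 ≠ G} => ι' D.1 with hT'
    have hmem : g ∈ Ideal.span (u' '' T') ⊔ (maximalIdeal (Z.presheaf.stalk x)) ^ 2 := by
      rw [hsum]
      refine Ideal.sum_mem _ fun j _ => ?_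
      by_cases hjS : j ∈ S
      · by_cases hjι : ∃ D : {D // D ∈ E ∧ x ∈ D.support}, ι D = j
        · obtain ⟨D, rfl⟩ := hjι
          -- `u (ι D)` generates `D_x`, as does `u' (ι' D')` for the corresponding member of `G :: E`
          have hDne : D.1 ≠ G := fun h => hGmem (h ▸ D.2.1)
          let D'' : {D // D ∈ G :: E ∧ x ∈ D.support} := ⟨D.1, ⟨List.mem_cons_of_mem G D.2.1, D.2.2⟩⟩
          let D' : {D : {D // D ∈ G :: E ∧ x ∈ D.support} // D.1 ≠ G} := ⟨D'', hDne⟩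
          have h1 : u (ι D) ∈ Ideal.span (u' '' T') := by
            have h2 : Ideal.span {u (ι D)} = Ideal.span {u' (ι' D'.1)} := by rw [← hιu D, ← hι'u' D'.1]
            have h3 : u (ι D) ∈ Ideal.span {u' (ι' D'.1)} := h2 ▸ Ideal.mem_span_singleton_self _
            refine Ideal.span_mono (Set.singleton_subset_iff.mpr ?_) h3
            have hT'mem : ι' D'.1 ∈ T' := by rw [hT']; exact ⟨D', rfl⟩
            exact ⟨ι' D'.1, hT'mem, rfl⟩
          exact Ideal.mem_sup_left (Ideal.mul_mem_left _ _ h1)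
        · push Not at hjι
          have hlj : l j ∈ maximalIdeal (Z.presheaf.stalk x) := by
            have := hno j hjS (fun D h => hjι D h)
            exact (IsLocalRing.mem_maximalIdeal _).mpr (mem_nonunits_iff.mpr this)
          exact Ideal.mem_sup_right (by rw [sq]; exact Ideal.mul_mem_mul hlj (hum j))
      · rw [hl0 j hjS, zero_mul]; exact Ideal.zero_mem _
    have hnot : ι' dG ∉ T' := by
      rintro ⟨D, hD⟩
      exact D.2 (congrArg (fun D : {D // D ∈ G :: E ∧ x ∈ D.support} => D.1) (hι' hD))
    exact not_mem_span_image_sup_sq_of_not_mem rfl u' hu' hnot hmem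
  obtain ⟨j₀, hj₀S, hj₀ι, hunit⟩ := hkey
  obtain ⟨a, ha⟩ := hunit
  -- `u_{j₀}` in terms of `g` and the other `u_j`, `j ∈ S`
  have huj₀ : u j₀ = ↑a⁻¹ * (g - ∑ j ∈ Finset.univ.erase j₀, l j * u j) := by
    rw [hsum, ← Finset.add_sum_erase _ _ (Finset.mem_univ j₀), ← ha, add_sub_cancel_right, ← mul_assoc, Units.inv_mul, one_mul]
  -- the new regular system
  set w : Fin _ → Z.presheaf.stalk x := Function.update u j₀ g with hw
  have hwj₀ : w j₀ = g := by rw [hw, Function.update_self]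
  have hwj : ∀ j, j ≠ j₀ → w j = u j := fun j hj => by rw [hw, Function.update_of_ne hj]
  have hgm : g ∈ maximalIdeal (Z.presheaf.stalk x) := by
    rw [hsum]; exact Ideal.sum_mem _ fun j _ => Ideal.mul_mem_left _ _ (hum j)
  -- `u_{j₀} ∈ (w_S)` and hence every `u_j`, `j ∈ S`, lies in `(w_S)`; and `range u ⊆ (range w)`
  have huS : ∀ S₀ : Set (Fin _), j₀ ∈ S₀ → S ⊆ S₀ → u j₀ ∈ Ideal.span (w '' S₀) := by
    intro S₀ hj₀ hSS₀
    rw [huj₀]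
    refine Ideal.mul_mem_left _ _ (Ideal.sub_mem _ (Ideal.subset_span ⟨j₀, hj₀, hwj₀⟩) (Ideal.sum_mem _ fun j hj => ?_))
    obtain ⟨hjne, -⟩ := Finset.mem_erase.mp hj
    by_cases hjS : j ∈ S
    · exact Ideal.mul_mem_left _ _ (Ideal.subset_span ⟨j, hSS₀ hjS, hwj j hjne⟩)
    · rw [hl0 j hjS, zero_mul]; exact Ideal.zero_mem _
  have hspan : Ideal.span (Set.range w) = maximalIdeal (Z.presheaf.stalk x) := by
    apply le_antisymm
    · rw [Ideal.span_le]; rintro _ ⟨j, rfl⟩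
      by_cases hj : j = j₀
      · subst hj; rw [hwj₀]; exact hgm
      · rw [hwj j hj]; exact hum j
    · calc maximalIdeal (Z.presheaf.stalk x) = Ideal.span (Set.range u) := hu.symm
        _ ≤ Ideal.span (Set.range w) := Ideal.span_le.mpr (by
          rintro _ ⟨j, rfl⟩
          by_cases hj : j = j₀
          · subst hj
            have := huS Set.univ (Set.mem_univ _) (Set.subset_univ _)
            rwa [Set.image_univ] at this
          · exact Ideal.subset_span ⟨j, hwj j hj⟩)
  -- labels
  let κ : {D // D ∈ G :: E ∧ x ∈ D.support} → Fin _ := fun D => if h : D.1 = G then j₀ else ι ⟨D.1, hmemE D h⟩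
  have hκG : ∀ D : {D // D ∈ G :: E ∧ x ∈ D.support}, D.1 = G → κ D = j₀ := fun D h => by simp [κ, h]
  have hκE : ∀ (D : {D // D ∈ G :: E ∧ x ∈ D.support}) (h : D.1 ≠ G), κ D = ι ⟨D.1, hmemE D h⟩ := fun D h => by simp [κ, h]
  refine ⟨hreg, w, hspan, ⟨κ, ?_, ?_⟩, fun _ => ⟨S, ?_⟩⟩
  · intro D₁ D₂ h12
    by_cases h1 : D₁.1 = G <;> by_cases h2 : D₂.1 = G
    · exact Subtype.ext (h1.trans h2.symm)
    · exact absurd ((hκE D₂ h2).symm.trans (h12.symm.trans (hκG D₁ h1))) (hj₀ι _)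
    · exact absurd ((hκE D₁ h1).symm.trans (h12.trans (hκG D₂ h2))) (hj₀ι _)
    · have := hι (show ι ⟨D₁.1, hmemE D₁ h1⟩ = ι ⟨D₂.1, hmemE D₂ h2⟩ by rw [← hκE D₁ h1, ← hκE D₂ h2, h12])
      exact Subtype.ext (congrArg (fun D : {D // D ∈ E ∧ x ∈ D.support} => (D.1 : Z.IdealSheafData)) this)
  · intro D
    by_cases h : D.1 = G
    · rw [hκG D h, hwj₀, h]; exact hGx
    · rw [hκE D h, hwj _ (hj₀ι _)]; exact hιu ⟨D.1, hmemE D h⟩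
  · -- `C_x = (u_S) = (w_S)`
    rw [hS]
    apply le_antisymm
    · rw [Ideal.span_le]; rintro _ ⟨j, hj, rfl⟩
      by_cases hjj : j = j₀
      · subst hjj; exact huS S hj₀S le_rfl
      · exact Ideal.subset_span ⟨j, hj, hwj j hjj⟩
    · rw [Ideal.span_le]; rintro _ ⟨j, hj, rfl⟩
      by_cases hjj : j = j₀
      · subst hjj; rw [hwj₀]; exact hgC
      · rw [hwj j hjj]; exact Ideal.subset_span ⟨j, hj, rfl⟩

end Summit.ResolutionOfSingularities.ResolutionOfSingularities.Theorems.X3LemmaM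

end
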